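import Mathlib.AlgebraicGeometry.Morphisms.Etale
import Mathlib.AlgebraicGeometry.Morphisms.UniversallyClosed
import HarnessLib

/-!
# A closed morphism étale at the points of a fibre is étale over a neighbourhood

Topic: `Literature/AlgebraicGeometry/Resolution`. The spreading step of de Jong 1996, proof of
Lemma 4.13 ("Therefore `f|_H : H → Y` is finite étale over a neighbourhood of `y` in `Y`", from
étaleness at the finitely many points of `H` over `y` and the closedness of the finite `f|_H`),
isolated as general bookkeeping on Mathlib's `Etale`:

* `etale_iSup_ι` — étaleness is local on the source: if `g` is étale on each open `V i` then on
  `⋃ V i`;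
* `exists_etale_morphismRestrict_of_forall_exists_opens` — if `g : H → Y` is a closed map
  (`UniversallyClosed`, e.g. finite) and every point of `H` over `y` has an open neighbourhood on
  which `g` is étale, then `g` is étale over an open neighbourhood `V` of `y`
  (`Etale (g ∣_ V)`): take `V = Y ∖ g(H ∖ O)` for `O` the union of all opens on which `g` is
  étale.

## Sources

* A. J. de Jong, *Smoothness, semi-stability and alterations*, Publ. Math. IHÉS 83 (1996),
  Lemma 4.13 (proof), p. 70. [DeJong1996]
-/

noncomputable section

open CategoryTheory CategoryTheory.Limits AlgebraicGeometry TopologicalSpace Topology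

namespace Literature.AlgebraicGeometry.Resolution

universe u

/-- Étaleness on the members of a family of opens gives étaleness on their union (étale is
Zariski-local on the source). [folklore] -/
theorem etale_iSup_ι {H Y : Scheme.{u}} (g : H ⟶ Y) {ι : Type*} (V : ι → H.Opens)
    (hV : ∀ i, Etale ((V i).ι ≫ g)) : Etale ((⨆ i, V i).ι ≫ g) := by
  refine IsZariskiLocalAtSource.of_iSup_eq_top (P := @Etale)
    (fun i => (⨆ i, V i).ι ⁻¹ᵁ (V i)) ?_ fun i => ?_
  · apply (⨆ i, V i).ι.image_injective
    dsimp
    rw [Scheme.Hom.image_iSup, Scheme.Hom.image_top_eq_opensRange, Scheme.Opens.opensRange_ι]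
    simp [Scheme.Hom.image_preimage_eq_opensRange_inf, le_iSup V]
  · have := hV i
    rw [← Category.assoc, ← Scheme.Opens.isoOfLE_hom_ι (le_iSup V i), Category.assoc]
    infer_instance

/-- **Étale at the points of a fibre, closed ⇒ étale over a neighbourhood** (the spreading step
of de Jong 1996, proof of 4.13: "Therefore `f|_H : H → Y` is finite étale over a neighbourhood
of `y`"): if `g : H → Y` is a closed map and every point of `H` over `y` has an open
neighbourhood `O` with `g|_O` étale, then there is an open `V ∋ y` with `g : g⁻¹(V) → V` étale.
With `O` the union of all opens on which `g` is étale, `V = Y ∖ g(H ∖ O)`.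
[cite: DeJong1996, Lemma 4.13 (proof), p. 70] -/
theorem exists_etale_morphismRestrict_of_forall_exists_opens {H Y : Scheme.{u}} (g : H ⟶ Y)
    [UniversallyClosed g] (y : Y)
    (hO : ∀ z : H, g z = y → ∃ O : H.Opens, z ∈ O ∧ Etale (O.ι ≫ g)) :
    ∃ V : Y.Opens, y ∈ V ∧ Etale (g ∣_ V) := by
  -- the union `O'` of all opens on which `g` is étale
  let 𝒮 := {O : H.Opens | Etale (O.ι ≫ g)}
  let O' : H.Opens := ⨆ O : 𝒮, (O : H.Opens)
  haveI hO' : Etale (O'.ι ≫ g) := etale_iSup_ι g (fun O : 𝒮 => (O : H.Opens)) fun O => O.2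
  have hy : ∀ z : H, g z = y → z ∈ O' := fun z hz => by
    obtain ⟨O, hzO, hOe⟩ := hO z hz
    exact Opens.mem_iSup.mpr ⟨⟨O, hOe⟩, hzO⟩
  -- `V = Y ∖ g(H ∖ O')`
  have hcl : IsClosed (g '' ((O' : Set H)ᶜ)) := g.isClosedMap _ O'.isOpen.isClosed_compl
  let V : Y.Opens := ⟨(g '' ((O' : Set H)ᶜ))ᶜ, hcl.isOpen_compl⟩
  have hyV : y ∈ V := by
    rintro ⟨z, hz, hzy⟩
    exact hz (hy z hzy)
  have hle : g ⁻¹ᵁ V ≤ O' := by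
    intro z hz
    by_contra hzO
    exact hz ⟨z, hzO, rfl⟩
  refine ⟨V, hyV, ?_⟩
  have heq : (g ∣_ V) ≫ V.ι = H.homOfLE hle ≫ O'.ι ≫ g := by
    rw [morphismRestrict_ι, ← Category.assoc, Scheme.homOfLE_ι]
  have hcomp : Etale ((g ∣_ V) ≫ V.ι) := by
    rw [heq]
    infer_instance
  exact MorphismProperty.of_postcomp @Etale (W' := @Etale) (g ∣_ V) V.ι inferInstance hcomp

end Literature.AlgebraicGeometry.Resolution

end
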